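import Mathlib
import Literature.MathematicalPhysics.QuantumFieldTheory.Multiboson
import Summits.QuantumFields.QCD.Theses.EulerDescent

/-!
# Sketch — crux idea `twisted-ray-goldstone` for `EulerDescent.ChiralCornerSoftness`
(stmt-QuantumFields-16902), ideator 2, round 1.

First checkable statements of the two crux ideas — ALL PROVED in this file (farm rc 0, zero sorries):

* `twisted_resolvent_identity` — the EXACT twisted-mass (PCVC) Ward identity of a Wilson doublet
  in its configuration-wise, linear-algebra form on the tree's Hermitian Wilson operator
  `H = Γ₅ D_W(U, m₀, 1)`: `(H + iμ)⁻¹ − (H − iμ)⁻¹ = −2iμ (H² + μ²)⁻¹`. Reading: u-quark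
  propagator `S_u = (D_W + m₀ + iμγ₅)⁻¹ = (H + iμ)⁻¹ Γ₅`, d-quark `S_d = (H − iμ)⁻¹ Γ₅`; the
  site-diagonal spin–colour trace of the left side is `⟨P³(x)⟩_U` (the flavour-parity / Aoki order
  parameter in the twisted direction), the right side is `2μ Σ_y G_{π±}(y, x)_U` (the charged-pion
  two-point function summed over the torus) — `2μ χ_⊥ = ⟨P³⟩` configuration by configuration.
* `ratio_le_of_logConvex_of_decay` — reflection-positivity self-improvement in sequence form: a
  positive, log-convex sequence dominated by `K e^{−r s}` drops by at least `e^{−r}` at EVERY step.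
* `flux_rate_bound` — the closing arithmetic: a lower bound `Λ ≤ Σ_{s≥t₀} C s` on the tail (the
  exact flux `Φ(t₀)/(2μ)`) and the one-step drop `e^{−r}` give `Λ (1 − e^{−r}) ≤ C t₀`, i.e. the
  lattice rate `r` of the charged-pion channel is at most `≈ C(t₀)/Λ = 2μ C_PP(t₀)/Φ(t₀)`.
-/

namespace Summit.QuantumFields.QCD.Cruxes.ChiralCornerSoftness.IdeateK2

open scoped Matrix
open Literature.Probability.LatticeModels Literature.MathematicalPhysics.QuantumLattice
open Literature.MathematicalPhysics.QuantumFieldTheory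

local notation "𝔾" => Matrix.specialUnitaryGroup (Fin 3) ℂ

/-- **Resolvent identity for a Hermitian matrix** (abstract form of the twisted Ward identity):
`(H + iμ)⁻¹ − (H − iμ)⁻¹ = −2iμ (H·H + μ²)⁻¹` for `H` Hermitian and real `μ ≠ 0` (both shifts
invertible: `det_sub_smul_one_ne_zero_of_isHermitian`). PROVED. [folklore] -/
theorem resolvent_identity_of_isHermitian {n : Type*} [Fintype n] [DecidableEq n]
    {H : Matrix n n ℂ} (hH : H.IsHermitian) (μ : ℝ) (hμ : μ ≠ 0) :
    (H + ((μ : ℂ) * Complex.I) • (1 : Matrix n n ℂ))⁻¹ -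
        (H - ((μ : ℂ) * Complex.I) • (1 : Matrix n n ℂ))⁻¹ =
      (-(2 * (μ : ℂ) * Complex.I)) • (H * H + ((μ ^ 2 : ℝ) : ℂ) • (1 : Matrix n n ℂ))⁻¹ := by
  set c : ℂ := (μ : ℂ) * Complex.I with hc
  set A : Matrix n n ℂ := H + c • 1 with hA
  set B : Matrix n n ℂ := H - c • 1 with hB
  have hcim : c.im ≠ 0 := by simp [hc, hμ]
  have hncim : (-c).im ≠ 0 := by simp [hc, hμ]
  have hBdet : B.det ≠ 0 := det_sub_smul_one_ne_zero_of_isHermitian hH hcim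
  have hAdet : A.det ≠ 0 := by
    have := det_sub_smul_one_ne_zero_of_isHermitian hH hncim
    simpa [hA, sub_neg_eq_add, neg_smul] using this
  have hAu : IsUnit A.det := isUnit_iff_ne_zero.mpr hAdet
  have hBu : IsUnit B.det := isUnit_iff_ne_zero.mpr hBdet
  have hI : c * c = -(((μ ^ 2 : ℝ) : ℂ)) := by
    simp only [hc]; push_cast; ring_nf; rw [Complex.I_sq]; ring
  have hBA : B * A = H * H + ((μ ^ 2 : ℝ) : ℂ) • (1 : Matrix n n ℂ) := by
    simp only [hA, hB, sub_mul, mul_add, Matrix.mul_smul, Matrix.smul_mul, mul_one, one_mul,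
      smul_smul, hI, neg_smul]
    abel
  have key : A⁻¹ - B⁻¹ = A⁻¹ * (B - A) * B⁻¹ := by
    have h1 : A⁻¹ * (B - A) * B⁻¹ = A⁻¹ * (B * B⁻¹) - (A⁻¹ * A) * B⁻¹ := by
      noncomm_ring
    rw [h1, Matrix.mul_nonsing_inv B hBu, Matrix.nonsing_inv_mul A hAu, mul_one, one_mul]
  have hdiff : B - A = (-(2 * c)) • (1 : Matrix n n ℂ) := by
    have h2 : (-(2 * c)) • (1 : Matrix n n ℂ) = -(c • (1 : Matrix n n ℂ)) - c • (1 : Matrix n n ℂ) := by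
      rw [two_mul, neg_add, add_smul, neg_smul, sub_eq_add_neg]
    rw [h2, hA, hB]
    abel
  rw [key, hdiff, Matrix.mul_smul, mul_one, Matrix.smul_mul, ← Matrix.mul_inv_rev, hBA]
  congr 1
  simp [hc]; ring

/-- **Twisted resolvent identity (exact PCVC, configuration-wise).** For the Hermitian Wilson
operator `H = Γ₅ D_W(U, m₀, 1)` on the torus of side `S` and a non-zero twisted mass `μ`,
`(H + iμ)⁻¹ − (H − iμ)⁻¹ = −2iμ · (H·H + μ²)⁻¹`. (Both shifted operators are invertible because
`H` is Hermitian, `det_sub_smul_one_ne_zero_of_isHermitian`; `H·H + μ² > 0`, `det_twisted_pos`.)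
[cite: FrezzottiGrassiSintWeisz2001, §2.1 (PCVC) and §4.3 (exact VWI, point-split current)] -/
theorem twisted_resolvent_identity {S : ℕ} [NeZero S] (U : GaugeConfig 4 S 𝔾) (m₀ μ : ℝ)
    (hμ : μ ≠ 0) :
    let H := spinorLift gammaFive * wilsonDirac (fundamentalRep (Fin 3)) U m₀ 1
    (H + ((μ : ℂ) * Complex.I) • (1 : Matrix _ _ ℂ))⁻¹ -
        (H - ((μ : ℂ) * Complex.I) • (1 : Matrix _ _ ℂ))⁻¹ =
      (-(2 * (μ : ℂ) * Complex.I)) • (H * H + ((μ ^ 2 : ℝ) : ℂ) • (1 : Matrix _ _ ℂ))⁻¹ := by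
  intro H
  exact resolvent_identity_of_isHermitian
    (isHermitian_gammaFive_mul_wilsonDirac_fundamental U m₀ 1) μ hμ

/-- **RP self-improvement, sequence form.** A positive log-convex sequence (`C (s+1)² ≤ C s ·
C (s+2)`: the spectral representation `C s = ∫ λ^s dν`, `λ ∈ [0,1)`, of a reflection-positive
two-point function) that is dominated by `K e^{−r s}` for all `s` drops by the factor `e^{−r}` at
every single step: the effective mass `log (C s / C (s+1))` is non-increasing in `s`, so it is
everywhere at least its limit, which the domination forces to be `≥ r`. [folklore] -/
theorem ratio_le_of_logConvex_of_decay (C : ℕ → ℝ) (hpos : ∀ s, 0 < C s)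
    (hlc : ∀ s, C (s + 1) ^ 2 ≤ C s * C (s + 2)) (K r : ℝ)
    (hdecay : ∀ s, C s ≤ K * Real.exp (-(r * s))) :
    ∀ s, C (s + 1) ≤ Real.exp (-r) * C s := by
  set q : ℝ := Real.exp (-r) with hq
  have hq0 : 0 < q := Real.exp_pos _
  -- ratios are non-decreasing (log-convexity)
  have hratio : ∀ s, C (s + 1) / C s ≤ C (s + 2) / C (s + 1) := by
    intro s
    rw [div_le_div_iff₀ (hpos s) (hpos (s + 1))]
    nlinarith [hlc s, hpos s, hpos (s + 1), hpos (s + 2)]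
  have hmono : ∀ s n, C (s + 1) / C s ≤ C (s + n + 1) / C (s + n) := by
    intro s n
    induction n with
    | zero => simp
    | succ n ih =>
      calc C (s + 1) / C s ≤ C (s + n + 1) / C (s + n) := ih
        _ ≤ C (s + n + 2) / C (s + n + 1) := hratio (s + n)
        _ = C (s + (n + 1) + 1) / C (s + (n + 1)) := by ring_nf
  by_contra hcon
  push Not at hcon
  obtain ⟨s₀, hs₀⟩ := hcon
  set ρ : ℝ := C (s₀ + 1) / C s₀ with hρ
  have hρq : q < ρ := by
    rw [hρ, lt_div_iff₀ (hpos s₀)]; linarith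
  have hρ0 : 0 < ρ := hq0.trans hρq
  -- geometric growth from s₀ on
  have hgrow : ∀ n, C s₀ * ρ ^ n ≤ C (s₀ + n) := by
    intro n
    induction n with
    | zero => simp
    | succ n ih =>
      have hstep : ρ ≤ C (s₀ + n + 1) / C (s₀ + n) := hmono s₀ n
      have hstep' : ρ * C (s₀ + n) ≤ C (s₀ + n + 1) := by
        rwa [le_div_iff₀ (hpos (s₀ + n))] at hstep
      calc C s₀ * ρ ^ (n + 1) = ρ * (C s₀ * ρ ^ n) := by ring
        _ ≤ ρ * C (s₀ + n) := by gcongr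
        _ ≤ C (s₀ + n + 1) := hstep'
        _ = C (s₀ + (n + 1)) := by ring_nf
  -- decay
  have hdecay' : ∀ n, C (s₀ + n) ≤ K * q ^ s₀ * q ^ n := by
    intro n
    have h := hdecay (s₀ + n)
    have hexp : Real.exp (-(r * ((s₀ + n : ℕ) : ℝ))) = q ^ s₀ * q ^ n := by
      rw [hq, ← Real.exp_nat_mul, ← Real.exp_nat_mul, ← Real.exp_add]
      congr 1; push_cast; ring
    calc C (s₀ + n) ≤ K * Real.exp (-(r * ((s₀ + n : ℕ) : ℝ))) := h
      _ = K * q ^ s₀ * q ^ n := by rw [hexp]; ring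
  -- hence (ρ/q)^n bounded: contradiction with ρ/q > 1
  have hbound : ∀ n, (ρ / q) ^ n ≤ K * q ^ s₀ / C s₀ := by
    intro n
    have h1 : C s₀ * ρ ^ n ≤ K * q ^ s₀ * q ^ n := (hgrow n).trans (hdecay' n)
    rw [div_pow, div_le_div_iff₀ (pow_pos hq0 n) (hpos s₀)]
    nlinarith [h1, pow_pos hq0 n, hpos s₀]
  have hgt : 1 < ρ / q := by rw [lt_div_iff₀ hq0]; linarith
  have htend := tendsto_pow_atTop_atTop_of_one_lt hgt
  obtain ⟨n, hn⟩ := (htend.eventually_gt_atTop (K * q ^ s₀ / C s₀)).exists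
  exact absurd (hbound n) (not_le.mpr hn)

/-- **Flux–rate bound (closing arithmetic of the line).** If the tail of `C` from `t₀` on is at
least `Λ > 0` (exact twisted flux: `Σ_{s ≥ t₀} C_PP(s) = Φ(t₀)/(2μ)`) and `C` drops by `e^{−r}` at
every step (previous lemma), then `Λ (1 − e^{−r}) ≤ C t₀`: the lattice rate of the channel obeys
`1 − e^{−r} ≤ C(t₀)/Λ = 2μ C_PP(t₀)/Φ(t₀)`. [folklore] -/
theorem flux_rate_bound (C : ℕ → ℝ) (hpos : ∀ s, 0 < C s) (r Λ : ℝ) (hr : 0 < r) (hΛ : 0 < Λ)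
    (t₀ : ℕ) (hstep : ∀ s, C (s + 1) ≤ Real.exp (-r) * C s) (hsum : Summable C)
    (hflux : Λ ≤ ∑' s, C (t₀ + s)) :
    Λ * (1 - Real.exp (-r)) ≤ C t₀ := by
  set q : ℝ := Real.exp (-r) with hq
  have hq0 : 0 ≤ q := (Real.exp_pos _).le
  have hq1 : q < 1 := by rw [hq]; exact Real.exp_lt_one_iff.mpr (by linarith)
  have hgeo : ∀ s, C (t₀ + s) ≤ C t₀ * q ^ s := by
    intro s
    induction s with
    | zero => simp
    | succ s ih =>
      calc C (t₀ + (s + 1)) = C (t₀ + s + 1) := by ring_nf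
        _ ≤ q * C (t₀ + s) := hstep _
        _ ≤ q * (C t₀ * q ^ s) := by gcongr
        _ = C t₀ * q ^ (s + 1) := by ring
  have hsum' : Summable (fun s => C (t₀ + s)) := by
    have := (summable_nat_add_iff t₀).mpr hsum
    simpa [add_comm] using this
  have hsumgeo : Summable (fun s => C t₀ * q ^ s) :=
    (summable_geometric_of_lt_one hq0 hq1).mul_left _
  have h1 : ∑' s, C (t₀ + s) ≤ ∑' s, C t₀ * q ^ s := hsum'.tsum_le_tsum hgeo hsumgeo
  have h2 : ∑' s, C t₀ * q ^ s = C t₀ * (1 - q)⁻¹ := by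
    rw [tsum_mul_left, tsum_geometric_of_lt_one hq0 hq1]
  have h3 : Λ ≤ C t₀ * (1 - q)⁻¹ := hflux.trans (h1.trans h2.le)
  have h1q : 0 < 1 - q := by linarith
  calc Λ * (1 - q) ≤ C t₀ * (1 - q)⁻¹ * (1 - q) := by gcongr
    _ = C t₀ := by field_simp

/-! ## Second idea `euler-share-floor`: upward Euler transport with gain + one anchor -/

/-- **Share floor + anchor ⇒ chirality at zero (closing logic of idea `euler-share-floor`).**
If along the degenerate line the uniform lattice gap transports UPWARD WITH GAIN — gap `Δ` at
renormalised mass `t ≤ m₁` forces gap `Δ'` at `m₁` for every `Δ' < (m₁/t)^θ Δ` (the lightest level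
owes at least the fraction `θ` of its mass to the quark-mass term: Euler share `≥ θ`, the dual of
`RayDescent`'s share `≤ 1`) — and at the anchor mass `m₁` some rate `Δ̄` is NOT a uniform gap
(no runaway), then the regularisation is chiral at zero: for `ε > 0` the mass
`t = m₁ (ε/(Δ̄+ε))^{1/θ}`-or-smaller has no uniform gap `ε`. Real arithmetic with `Real.rpow`;
provable now. [folklore] -/
theorem isChiralAtZero_of_shareFloor_of_anchor {Nf : ℕ} (reg : QCDRegularisation Nf)
    (θ m₁ Δbar : ℝ) (hθ : 0 < θ) (hm₁ : 0 < m₁) (hΔ : 0 < Δbar)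
    (htrans : ∀ t : ℝ, 0 < t → t ≤ m₁ → ∀ Δ : ℝ, 0 < Δ →
      (reg.scheme (fun _ => t) 0 0).HasLatticeMassGap Δ →
        ∀ Δ' : ℝ, 0 < Δ' → Δ' < (m₁ / t) ^ θ * Δ →
          (reg.scheme (fun _ => m₁) 0 0).HasLatticeMassGap Δ')
    (hanchor : ¬ (reg.scheme (fun _ => m₁) 0 0).HasLatticeMassGap Δbar) :
    reg.IsChiralAtZero := by
  intro ε hε
  set y : ℝ := ε / (Δbar + ε) with hy
  have hy0 : 0 < y := by rw [hy]; positivity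
  have hy1 : y < 1 := by rw [hy, div_lt_one (by positivity)]; linarith
  set x : ℝ := y ^ (1 / θ) with hx
  have hx0 : 0 < x := Real.rpow_pos_of_pos hy0 _
  have hx1 : x < 1 := Real.rpow_lt_one hy0.le hy1 (by positivity)
  have hxθ : x ^ θ = y := by
    rw [hx, ← Real.rpow_mul hy0.le, one_div, inv_mul_cancel₀ hθ.ne', Real.rpow_one]
  set t : ℝ := m₁ * x with ht
  have ht0 : 0 < t := mul_pos hm₁ hx0
  have htle : t ≤ m₁ := by
    have : m₁ * x ≤ m₁ * 1 := by gcongr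
    simpa [ht] using this
  have hpow : (m₁ / t) ^ θ = (Δbar + ε) / ε := by
    have hmt : m₁ / t = x⁻¹ := by
      rw [ht]; field_simp
    rw [hmt, Real.inv_rpow hx0.le, hxθ, hy, inv_div]
  refine ⟨fun _ => t, fun _ => ht0, fun hgap => hanchor ?_⟩
  refine htrans t ht0 htle ε hε hgap Δbar hΔ ?_
  rw [hpow, div_mul_cancel₀ _ hε.ne']
  linarith

/-- **Upward Euler transport with gain (the share floor), ∀-form over pinned regularisations** —
the statement shape of stub T1 of idea `euler-share-floor` (signature only; informal: eventually in
`k` is built into `HasLatticeMassGap`). -/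
def ShareFloorTransport : Prop :=
  ∀ Nf : ℕ, Nf = 2 ∨ Nf = 3 → ∀ (reg : QCDRegularisation Nf) (mc : ℕ → ℝ),
    (∀ᶠ k in Filter.atTop, IsLUB {μ : ℝ | ¬ (∀ (R R' : ℕ) (A : QCDLatticeObservable Nf R)
      (B : QCDLatticeObservable Nf R'), ∃ (C δ : ℝ) (S₀ : ℕ), 0 < δ ∧ ∀ S : ℕ, S₀ ≤ S → ∀ n : ℕ,
        n ≤ S → ‖qcdLatticeConnectedCorr (reg.β k) (2 * S + 1) (fun _ : Fin Nf => μ) A B n‖ ≤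
          C * Real.exp (-(δ * n)))} (mc k)) →
    Filter.Tendsto (fun k => (reg.mcrit k - mc k) * reg.Zm k / reg.a k) Filter.atTop (nhds 0) →
    reg.HasMassScaling → (reg.scheme 0 0 0).HasAsymptoticScaling →
    (∀ᶠ k in Filter.atTop, (-1 : ℝ) < reg.mcrit k) →
    ∃ θ > (0 : ℝ), ∃ m₁ > (0 : ℝ), ∀ t : ℝ, 0 < t → ∀ l : ℝ, 1 ≤ l → l * t ≤ m₁ →
      ∀ Δ : ℝ, 0 < Δ → (reg.scheme (fun _ => t) 0 0).HasLatticeMassGap Δ →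
        ∀ Δ' : ℝ, 0 < Δ' → Δ' < l ^ θ * Δ → (reg.scheme (fun _ => l * t) 0 0).HasLatticeMassGap Δ'

/-- Informational: the crux this idea is filed against (type-checks the import and the name). -/
example : Prop := Summit.QuantumFields.QCD.Theses.EulerDescent.ChiralCornerSoftness

end Summit.QuantumFields.QCD.Cruxes.ChiralCornerSoftness.IdeateK2
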